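import Literature.Analysis.FluidPDE.Tao2016AveragedNS.QuadraticCircuits
import HarnessLib

/-!
# Uniform viscosity is a change of clock, part 1 of 3: the viscous conjugacy of homogeneous
# quadratic circuits

PLACEMENT: cell-own derived work of `pub-fluidc` (blueprint seat bp1, owner of the Tao-2016 skeleton
`Literature/Analysis/FluidPDE/Tao2016AveragedNS/` and of its dictionary), filed under the host summit's topic
directory `Summits/NavierStokesRegularity/FluidComputer/` per the hub's 2026-08-19 placement rule (new derived
work here; `Literature/` holds cited published statements only). ONE text in three files (400-line rule of
the topic directory), one namespace `Summit.NavierStokesRegularity.FluidComputer.ViscousConjugacy`: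
this file (§1 clocks, §2 conjugacy — any real normed space), `ViscousConjugacyCertificate.lean` (§3 transport
of reach certificates and adversaries, §4 the uniformly damped member of [Tao2016AveragedNS, §5.5] and its
flow), `ViscousConjugacyGate.lean` (§4' how much uniform viscosity Tao's gate tolerates — fires for `μ < 4/7`,
never for `μ ≥ 5/7` — and §5 the viscous cone certificates). The Literature vocabulary (`energy`,
`IsCancelling`, `delayCircuitWith`, `delayFlowWith`, `delayInit`, `QuietOn`/`FiredOn`/`firedSet`,
`ReachCertificate`, `coneFrom`) is opened, never modified.

HONEST FRAMING (cell `pub-fluidc`, verbatim): *low prior, high value-of-information experiment on Tao's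
machine paradigm; NOT a claim that NS blows up.* Everything in the three files concerns finite-dimensional
quadratic ODEs with a UNIFORM linear damping `-μX`; nothing is said about the Navier–Stokes equations, whose
dissipation `νΔ` is NOT uniform across a wavelet shell (see "What is NOT claimed").

## The identity

Let `F` be homogeneous quadratic, `F (c • X) = c² • F X` (every gate of [Tao2016AveragedNS, §5] and every
superposition of gates), and `μ > 0`. Put

  `κ_μ(t) := (1 - e^{-μt})/μ`  (`viscClock`, the INVISCID CLOCK),  `T_μ(τ) := -log(1 - μτ)/μ`  (`viscTime`).

For every inviscid trajectory `Ż = F Z` the curve `X(t) := e^{-μt} • Z(κ_μ(t))` solves the uniformly damped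
system `Ẋ = F X - μX` (`hasDerivAt_damp_of_solution`): **a uniformly damped homogeneous quadratic machine
performs, in infinite time, exactly the inviscid computation up to inviscid time `1/μ`
(`tendsto_viscClock`, `viscClock_lt_inv`), read through the shrinking factor `1 - μκ = e^{-μt}`.** This is
the rescaling `X ↦ λX, t ↦ t/λ` of [Tao2016AveragedNS, Remark 6.1] made time-dependent, `λ(t) = e^{-μt}`;
recorded as [folklore]. With defects: an inviscid admissible curve with defect `W - F x` becomes a viscous
one with defect `e^{-2μt} • (W - F x)` (`hasDerivAt_damp`, `hasDerivWithinAt_damp`), a viscous one with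
defect `D` an inviscid one with defect `(1 - μs)⁻² • D` (`hasDerivWithinAt_undamp`).

## Contents of this file

* §1 `viscClock`, `viscTime`: mutually inverse on `μτ < 1`, strictly monotone, `κ_μ < 1/μ`, `κ_μ(t) ≤ t`,
  `κ_μ → 1/μ`, derivatives `e^{-μt}` and `(1 - μτ)⁻¹`.
* §2 `damped F μ := F - μ•id`; the three conjugacy lemmas; `hasDerivAt_smul_comp_mul` (constant
  rescaling of exact trajectories); the energy law `energy (X t) = e^{-2μt} energy (X 0)` of a damped
  cancelling circuit (`energy_eq_of_damped`); `lipschitzOnWith_damped`.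

## What is NOT claimed (all three files)

(i) The conjugacy is exact ONLY for damping uniform across the modes of a stage. The dissipation of a
wavelet shell is diagonal but NOT uniform (rates spread over `[λ_n², (1+ε₀)²λ_n²]`; the modes `a, b, c, d, ã`
of [Tao2016AveragedNS, §5.5] live at different frequencies); the non-uniform part `-(D - μ)X` is NOT
conjugated away and can at present only be charged to the adversarial defect budget `~ ε²e^{-M}` of the
reach certificates — an open item of the cell, not a theorem. (ii) Nothing about the averaged or the true
Navier–Stokes equations, blow-up, or Tao's infinite circuit. (iii) The viscous threshold of part 3 is a
property of the five-mode member (5.5) at the constants of Theorem 5.3 as formalised in the skeleton, and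
the gap `(4/7, 5/7)` is the un-located image of the transition window `[7/5, 7/4]`.

Sources: [cite: Tao2016AveragedNS, §5 (g-cancel), §5.5 (5.5); Remark 6.1]; the clock change is elementary
[folklore]. No named facts (D-0026); 0 sorry.
-/

noncomputable section

namespace Summit.NavierStokesRegularity.FluidComputer

open Real Set Metric Filter Topology
open scoped NNReal Pointwise
open Literature.Analysis.FluidPDE.Tao2016AveragedNS

namespace ViscousConjugacy

/-! ## §1. The two clocks -/

/-- The INVISCID CLOCK of a uniformly damped homogeneous quadratic circuit: after viscous time `t` the
machine has performed the inviscid computation up to time `κ_μ(t) = (1 - e^{-μt})/μ` (`μ ≠ 0`).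
[folklore] -/
def viscClock (μ t : ℝ) : ℝ := (1 - exp (-(μ * t))) / μ

/-- The VISCOUS TIME at which the inviscid clock shows `τ`: `T_μ(τ) = -log(1 - μτ)/μ` (meaningful for
`μτ < 1`; beyond, Mathlib's junk `log`). [folklore] -/
def viscTime (μ τ : ℝ) : ℝ := -Real.log (1 - μ * τ) / μ

variable {μ : ℝ}

/-- `κ_μ(0) = 0`. [folklore] -/
@[simp] theorem viscClock_zero (μ : ℝ) : viscClock μ 0 = 0 := by simp [viscClock]

/-- `T_μ(0) = 0`. [folklore] -/
@[simp] theorem viscTime_zero (μ : ℝ) : viscTime μ 0 = 0 := by simp [viscTime]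

/-- `1 - μ κ_μ(t) = e^{-μt}`: the shrinking factor read on the inviscid clock. [folklore] -/
theorem one_sub_mul_viscClock (hμ : μ ≠ 0) (t : ℝ) : 1 - μ * viscClock μ t = exp (-(μ * t)) := by
  unfold viscClock
  rw [mul_div_assoc', mul_div_cancel_left₀ _ hμ, sub_sub_cancel]

/-- `κ_μ(T_μ(τ)) = τ` for `μτ < 1`. [folklore] -/
theorem viscClock_viscTime (hμ : μ ≠ 0) {τ : ℝ} (h : μ * τ < 1) :
    viscClock μ (viscTime μ τ) = τ := by
  have hq : 0 < 1 - μ * τ := by linarith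
  unfold viscClock viscTime
  have e1 : μ * (-Real.log (1 - μ * τ) / μ) = -Real.log (1 - μ * τ) := by
    rw [mul_div_assoc', mul_div_cancel_left₀ _ hμ]
  rw [e1, neg_neg, Real.exp_log hq, sub_sub_cancel, mul_div_cancel_left₀ _ hμ]

/-- `T_μ(κ_μ(t)) = t`. [folklore] -/
theorem viscTime_viscClock (hμ : μ ≠ 0) (t : ℝ) : viscTime μ (viscClock μ t) = t := by
  unfold viscTime
  rw [one_sub_mul_viscClock hμ, Real.log_exp, neg_neg, mul_div_cancel_left₀ _ hμ]

/-- `e^{-μ T_μ(τ)} = 1 - μτ` for `μτ < 1`. [folklore] -/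
theorem exp_neg_mul_viscTime (hμ : μ ≠ 0) {τ : ℝ} (h : μ * τ < 1) :
    exp (-(μ * viscTime μ τ)) = 1 - μ * τ := by
  have e := one_sub_mul_viscClock hμ (viscTime μ τ)
  rw [viscClock_viscTime hμ h] at e
  exact e.symm

/-- `μ κ_μ(t) < 1`: the inviscid clock never passes `1/μ`. [folklore] -/
theorem mul_viscClock_lt_one (hμ : μ ≠ 0) (t : ℝ) : μ * viscClock μ t < 1 := by
  have h := one_sub_mul_viscClock hμ t
  linarith [exp_pos (-(μ * t))]

/-- `κ_μ(t) < 1/μ` (`μ > 0`). [folklore] -/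
theorem viscClock_lt_inv (hμ : 0 < μ) (t : ℝ) : viscClock μ t < 1 / μ := by
  rw [lt_div_iff₀ hμ, mul_comm]
  exact mul_viscClock_lt_one hμ.ne' t

/-- `κ_μ(t) ≤ t` (`μ > 0`): viscosity only slows the inviscid clock. [folklore] -/
theorem viscClock_le_self (hμ : 0 < μ) (t : ℝ) : viscClock μ t ≤ t := by
  have h1 := one_sub_mul_viscClock hμ.ne' t
  have h2 : -(μ * t) + 1 ≤ exp (-(μ * t)) := add_one_le_exp _
  have h3 : μ * viscClock μ t ≤ μ * t := by linarith
  exact le_of_mul_le_mul_left h3 hμ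

/-- The inviscid clock is strictly increasing (`μ > 0`). [folklore] -/
theorem strictMono_viscClock (hμ : 0 < μ) : StrictMono (viscClock μ) := by
  intro a b hab
  have ha := one_sub_mul_viscClock hμ.ne' a
  have hb := one_sub_mul_viscClock hμ.ne' b
  have h1 : μ * a < μ * b := mul_lt_mul_of_pos_left hab hμ
  have h : exp (-(μ * b)) < exp (-(μ * a)) := Real.exp_lt_exp.2 (by linarith)
  have h2 : μ * viscClock μ a < μ * viscClock μ b := by linarith
  exact lt_of_mul_lt_mul_left h2 hμ.le

/-- `κ_μ(a) ≤ κ_μ(b) ↔ a ≤ b` (`μ > 0`). [folklore] -/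
theorem viscClock_le_viscClock_iff (hμ : 0 < μ) {a b : ℝ} :
    viscClock μ a ≤ viscClock μ b ↔ a ≤ b :=
  (strictMono_viscClock hμ).le_iff_le

/-- `κ_μ(a) < κ_μ(b) ↔ a < b` (`μ > 0`). [folklore] -/
theorem viscClock_lt_viscClock_iff (hμ : 0 < μ) {a b : ℝ} :
    viscClock μ a < viscClock μ b ↔ a < b :=
  (strictMono_viscClock hμ).lt_iff_lt

/-- `0 ≤ κ_μ(t)` for `t ≥ 0` (`μ > 0`). [folklore] -/
theorem viscClock_nonneg (hμ : 0 < μ) {t : ℝ} (ht : 0 ≤ t) : 0 ≤ viscClock μ t := by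
  simpa using (viscClock_le_viscClock_iff hμ).2 ht

/-- `T_μ` is increasing on `μτ < 1` (`μ > 0`). [folklore] -/
theorem viscTime_le_viscTime (hμ : 0 < μ) {a b : ℝ} (hab : a ≤ b) (hb : μ * b < 1) :
    viscTime μ a ≤ viscTime μ b := by
  have ha : μ * a < 1 := lt_of_le_of_lt (mul_le_mul_of_nonneg_left hab hμ.le) hb
  rw [← viscClock_le_viscClock_iff hμ, viscClock_viscTime hμ.ne' ha, viscClock_viscTime hμ.ne' hb]
  exact hab

/-- `T_μ` is strictly increasing on `μτ < 1` (`μ > 0`). [folklore] -/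
theorem viscTime_lt_viscTime (hμ : 0 < μ) {a b : ℝ} (hab : a < b) (hb : μ * b < 1) :
    viscTime μ a < viscTime μ b := by
  have ha : μ * a < 1 := (mul_lt_mul_of_pos_left hab hμ).trans hb
  rw [← viscClock_lt_viscClock_iff hμ, viscClock_viscTime hμ.ne' ha, viscClock_viscTime hμ.ne' hb]
  exact hab

/-- `0 ≤ T_μ(τ)` for `0 ≤ τ`, `μτ < 1` (`μ > 0`). [folklore] -/
theorem viscTime_nonneg (hμ : 0 < μ) {τ : ℝ} (h0 : 0 ≤ τ) (h : μ * τ < 1) : 0 ≤ viscTime μ τ := by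
  simpa using viscTime_le_viscTime hμ h0 h

/-- `κ_μ(t) → 1/μ` as `t → ∞` (`μ > 0`): in infinite viscous time the damped machine performs exactly
the inviscid computation up to inviscid time `1/μ`. [folklore] -/
theorem tendsto_viscClock (hμ : 0 < μ) : Tendsto (viscClock μ) atTop (𝓝 (1 / μ)) := by
  have h1 : Tendsto (fun t : ℝ => exp (-(μ * t))) atTop (𝓝 0) := by
    have := Real.tendsto_exp_neg_atTop_nhds_zero.comp (tendsto_id.const_mul_atTop hμ)
    simpa [Function.comp_def] using this
  have h2 : Tendsto (fun t : ℝ => (1 - exp (-(μ * t))) / μ) atTop (𝓝 ((1 - 0) / μ)) :=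
    ((tendsto_const_nhds (x := (1 : ℝ))).sub h1).div_const μ
  rw [sub_zero] at h2
  exact h2

/-- The inviscid clock is continuous. [folklore] -/
theorem continuous_viscClock (μ : ℝ) : Continuous (viscClock μ) := by
  unfold viscClock
  fun_prop

/-- `κ_μ'(t) = e^{-μt}`. [folklore] -/
theorem hasDerivAt_viscClock (hμ : μ ≠ 0) (t : ℝ) : HasDerivAt (viscClock μ) (exp (-(μ * t))) t := by
  have h1 : HasDerivAt (fun s : ℝ => -(μ * s)) (-μ) t := by
    simpa [neg_mul] using (hasDerivAt_id t).const_mul (-μ)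
  have h2 := (h1.exp.const_sub 1).div_const μ
  refine h2.congr_deriv ?_
  rw [mul_neg, neg_neg, mul_div_assoc, div_self hμ, mul_one]

/-- `T_μ'(τ) = (1 - μτ)⁻¹` for `μτ < 1`. [folklore] -/
theorem hasDerivAt_viscTime (hμ : μ ≠ 0) {τ : ℝ} (h : μ * τ < 1) :
    HasDerivAt (viscTime μ) (1 - μ * τ)⁻¹ τ := by
  have hq : (1 - μ * τ) ≠ 0 := by
    have : 0 < 1 - μ * τ := by linarith
    exact this.ne'
  have h1 : HasDerivAt (fun s : ℝ => 1 - μ * s) (-μ) τ := by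
    simpa using ((hasDerivAt_id τ).const_mul μ).const_sub 1
  have h2 := ((h1.log hq).neg).div_const μ
  refine h2.congr_deriv ?_
  field_simp

/-! ## §2. The conjugacy (any real normed space) -/

section General

variable {O : Type*} [NormedAddCommGroup O] [NormedSpace ℝ O]

/-- **Uniform damping** of a design field: `damped F μ X = F X - μ • X`. [folklore] -/
def damped (F : O → O) (μ : ℝ) : O → O := fun X => F X - μ • X

/-- `damped F μ X = F X - μ • X`. [folklore] -/
@[simp] theorem damped_apply (F : O → O) (μ : ℝ) (X : O) : damped F μ X = F X - μ • X := rfl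

/-- `μ = 0` is the undamped field. [folklore] -/
theorem damped_zero (F : O → O) : damped F 0 = F := by
  funext X
  simp [damped]

variable {F : O → O}

/-- **THE CONJUGACY, forward (with defect).** If `x` has derivative `V` at the inviscid time `κ_μ(t)`
then `t ↦ e^{-μt} • x(κ_μ t)` has derivative `damped F μ (e^{-μt} • x(κ_μ t)) + e^{-2μt} • (V - F (x (κ_μ t)))`
at `t` (`F` homogeneous quadratic, `μ ≠ 0`): the inviscid defect is heard damped by `e^{-2μt}`. [folklore] -/
theorem hasDerivAt_damp (hF : ∀ (c : ℝ) (X : O), F (c • X) = c ^ 2 • F X) (hμ : μ ≠ 0)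
    {x : ℝ → O} {V : O} {t : ℝ} (hx : HasDerivAt x V (viscClock μ t)) :
    HasDerivAt (fun s => exp (-(μ * s)) • x (viscClock μ s))
      (damped F μ (exp (-(μ * t)) • x (viscClock μ t)) +
        exp (-(μ * t)) ^ 2 • (V - F (x (viscClock μ t)))) t := by
  have h1 : HasDerivAt (fun s : ℝ => -(μ * s)) (-μ) t := by
    simpa [neg_mul] using (hasDerivAt_id t).const_mul (-μ)
  have he : HasDerivAt (fun s : ℝ => exp (-(μ * s))) (exp (-(μ * t)) * -μ) t := h1.exp
  have hc : HasDerivAt (x ∘ viscClock μ) (exp (-(μ * t)) • V) t :=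
    hx.scomp t (hasDerivAt_viscClock hμ t)
  have h := he.smul hc
  refine h.congr_deriv ?_
  simp only [Function.comp_apply, damped_apply]
  rw [hF]
  module

/-- **THE CONJUGACY, forward (exact).** If `Z` solves the inviscid system `Ż = F Z` then
`t ↦ e^{-μt} • Z(κ_μ t)` solves the uniformly damped system `Ẋ = F X - μ X` (`μ ≠ 0`). [folklore] -/
theorem hasDerivAt_damp_of_solution (hF : ∀ (c : ℝ) (X : O), F (c • X) = c ^ 2 • F X) (hμ : μ ≠ 0)
    {Z : ℝ → O} (hZ : ∀ τ, HasDerivAt Z (F (Z τ)) τ) (t : ℝ) :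
    HasDerivAt (fun s => exp (-(μ * s)) • Z (viscClock μ s))
      (damped F μ (exp (-(μ * t)) • Z (viscClock μ t))) t := by
  have h := hasDerivAt_damp hF hμ (hZ (viscClock μ t))
  rw [sub_self, smul_zero, add_zero] at h
  exact h

/-- The forward conjugacy for RIGHT derivatives (admissible curves of the reach interface), `μ > 0`.
[folklore] -/
theorem hasDerivWithinAt_damp (hF : ∀ (c : ℝ) (X : O), F (c • X) = c ^ 2 • F X) (hμ : 0 < μ)
    {x : ℝ → O} {W : O} {t : ℝ} (hx : HasDerivWithinAt x W (Ici (viscClock μ t)) (viscClock μ t)) :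
    HasDerivWithinAt (fun s => exp (-(μ * s)) • x (viscClock μ s))
      (damped F μ (exp (-(μ * t)) • x (viscClock μ t)) +
        exp (-(μ * t)) ^ 2 • (W - F (x (viscClock μ t)))) (Ici t) t := by
  have h1 : HasDerivAt (fun s : ℝ => -(μ * s)) (-μ) t := by
    simpa [neg_mul] using (hasDerivAt_id t).const_mul (-μ)
  have he : HasDerivWithinAt (fun s : ℝ => exp (-(μ * s))) (exp (-(μ * t)) * -μ) (Ici t) t :=
    h1.exp.hasDerivWithinAt
  have hmaps : MapsTo (viscClock μ) (Ici t) (Ici (viscClock μ t)) := fun s hs =>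
    (strictMono_viscClock hμ).monotone hs
  have hc : HasDerivWithinAt (x ∘ viscClock μ) (exp (-(μ * t)) • W) (Ici t) t :=
    hx.scomp t (hasDerivAt_viscClock hμ.ne' t).hasDerivWithinAt hmaps
  have h := he.smul hc
  refine h.congr_deriv ?_
  simp only [Function.comp_apply, damped_apply]
  rw [hF]
  module

/-- **THE CONJUGACY, backward (right derivatives).** If `y` (a curve in viscous time) has right
derivative `W` at `T_μ(s)` (`μ > 0`, `μs < 1`) then the UNDAMPED curve `r ↦ (1 - μr)⁻¹ • y (T_μ r)` (in
inviscid time) has right derivative `(1 - μs)⁻² • (W + μ • y (T_μ s))` at `s`; so a viscous defect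
`W - damped F μ (y·)` is heard undamped as `(1 - μs)⁻² • (W - damped F μ (y·))`. [folklore] -/
theorem hasDerivWithinAt_undamp (hμ : 0 < μ) {y : ℝ → O} {W : O} {s : ℝ} (hs : μ * s < 1)
    (hy : HasDerivWithinAt y W (Ici (viscTime μ s)) (viscTime μ s)) :
    HasDerivWithinAt (fun r => (1 - μ * r)⁻¹ • y (viscTime μ r))
      (((1 - μ * s)⁻¹) ^ 2 • (W + μ • y (viscTime μ s))) (Ici s) s := by
  have hq : 0 < 1 - μ * s := by linarith
  have hs' : s < 1 / μ := by
    rw [lt_div_iff₀ hμ, mul_comm]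
    exact hs
  have hmaps : MapsTo (viscTime μ) (Ico s (1 / μ)) (Ici (viscTime μ s)) := by
    intro r hr
    have hr1 : μ * r < 1 := by
      rw [mul_comm]
      exact (lt_div_iff₀ hμ).1 hr.2
    exact viscTime_le_viscTime hμ hr.1 hr1
  have hc : HasDerivWithinAt (y ∘ viscTime μ) ((1 - μ * s)⁻¹ • W) (Ico s (1 / μ)) s :=
    hy.scomp s (hasDerivAt_viscTime hμ.ne' hs).hasDerivWithinAt hmaps
  have hc' : HasDerivWithinAt (y ∘ viscTime μ) ((1 - μ * s)⁻¹ • W) (Ici s) s :=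
    hc.mono_of_mem_nhdsWithin (Ico_mem_nhdsGE hs')
  have h1 : HasDerivAt (fun r : ℝ => 1 - μ * r) (-μ) s := by
    simpa using ((hasDerivAt_id s).const_mul μ).const_sub 1
  have hi : HasDerivWithinAt (fun r : ℝ => (1 - μ * r)⁻¹) (-(-μ) / (1 - μ * s) ^ 2) (Ici s) s :=
    (h1.inv hq.ne').hasDerivWithinAt
  have h := hi.smul hc'
  refine h.congr_deriv ?_
  simp only [Function.comp_apply]
  have e1 : -(-μ) / (1 - μ * s) ^ 2 = (1 - μ * s)⁻¹ ^ 2 * μ := by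
    field_simp
  rw [e1]
  module

/-- Rescaling an exact inviscid trajectory: `s ↦ c • Z (c s)` solves `Ẋ = F X` again (homogeneity;
[Tao2016AveragedNS, Remark 6.1]). [folklore] -/
theorem hasDerivAt_smul_comp_mul (hF : ∀ (c : ℝ) (X : O), F (c • X) = c ^ 2 • F X) {Z : ℝ → O}
    {c s : ℝ} (hZ : HasDerivAt Z (F (Z (c * s))) (c * s)) :
    HasDerivAt (fun r => c • Z (c * r)) (F (c • Z (c * s))) s := by
  have h1 : HasDerivAt (fun r : ℝ => c * r) c s := by
    simpa using (hasDerivAt_id s).const_mul c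
  have h2 := (hZ.scomp s h1).const_smul c
  rw [hF]
  rw [smul_smul, ← pow_two] at h2
  exact h2

/-- **Energy law of a uniformly damped cancelling circuit**: `energy (X t) = e^{-2μt} energy (X 0)` for
`t ≥ 0` along every solution of `Ẋ = F X - μX` on `[0, ∞)` with `F` cancelling (`F(X)·X = 0`,
[Tao2016AveragedNS, §5 (g-cancel)]). [folklore] -/
theorem energy_eq_of_damped {m : ℕ} {G : (Fin m → ℝ) → (Fin m → ℝ)} (hG : IsCancelling G) {μ : ℝ}
    {X : ℝ → Fin m → ℝ} (hX : ∀ t, 0 ≤ t → HasDerivAt X (damped G μ (X t)) t) {t : ℝ} (ht : 0 ≤ t) :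
    energy (X t) = exp (-(2 * μ * t)) * energy (X 0) := by
  have hg : ∀ r, 0 ≤ r → HasDerivAt (fun r => exp (2 * μ * r) * energy (X r)) 0 r := by
    intro r hr
    have h1 : HasDerivAt (fun r : ℝ => 2 * μ * r) (2 * μ) r := by
      simpa using (hasDerivAt_id r).const_mul (2 * μ)
    have hE := hasDerivAt_energy (hX r hr)
    have hs : ∑ i, damped G μ (X r) i * X r i = -μ * energy (X r) := by
      calc ∑ i, damped G μ (X r) i * X r i = ∑ i, (G (X r) i * X r i - μ * X r i ^ 2) :=
            Finset.sum_congr rfl fun i _ => by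
              simp only [damped_apply, Pi.sub_apply, Pi.smul_apply, smul_eq_mul]
              ring
        _ = ∑ i, G (X r) i * X r i - μ * ∑ i, X r i ^ 2 := by
            rw [Finset.sum_sub_distrib, Finset.mul_sum]
        _ = -μ * energy (X r) := by
            rw [hG (X r)]
            simp only [energy]
            ring
    have h := h1.exp.mul hE
    rw [hs] at h
    refine h.congr_deriv ?_
    ring
  have hcont : ContinuousOn (fun r => exp (2 * μ * r) * energy (X r)) (Icc 0 t) :=
    fun r hr => (hg r hr.1).continuousAt.continuousWithinAt
  have hc := constant_of_has_deriv_right_zero hcont (fun r hr => (hg r hr.1).hasDerivWithinAt) t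
    (right_mem_Icc.2 ht)
  simp only [mul_zero, exp_zero, one_mul] at hc
  rw [← hc, ← mul_assoc, ← Real.exp_add, neg_add_cancel, exp_zero, one_mul]

/-- Uniform damping keeps local Lipschitz bounds (constant `+ |μ|`). [folklore] -/
theorem lipschitzOnWith_damped {L : ℝ≥0} {s : Set O} (hFL : LipschitzOnWith L F s) (μ : ℝ) :
    LipschitzOnWith (L + ‖μ‖₊) (damped F μ) s := by
  refine LipschitzOnWith.of_dist_le_mul fun x hx y hy => ?_
  have h1 : ‖F x - F y‖ ≤ L * ‖x - y‖ := by
    rw [← dist_eq_norm, ← dist_eq_norm]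
    exact hFL.dist_le_mul x hx y hy
  have e : damped F μ x - damped F μ y = (F x - F y) - μ • (x - y) := by
    simp only [damped_apply, smul_sub]
    abel
  rw [dist_eq_norm, dist_eq_norm, e, NNReal.coe_add, coe_nnnorm, add_mul]
  calc ‖F x - F y - μ • (x - y)‖ ≤ ‖F x - F y‖ + ‖μ • (x - y)‖ := norm_sub_le _ _
    _ ≤ L * ‖x - y‖ + ‖μ‖ * ‖x - y‖ := add_le_add h1 (by rw [norm_smul])

end General

end ViscousConjugacy

end Summit.NavierStokesRegularity.FluidComputer
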